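import Literature.Computability.Cryptography.LWERegevCore
import HarnessLib

/-!
# Regev's decision-to-search reduction, III: the flat layout of its randomness

Topic `Computability/Cryptography` (LWE), grouping namespace `LWE.RegevReduction`, continuing
`LWERegevCore.lean`. The core success bound there is stated for the structured sample space
`Outer` (round ↦ shift × (estimate ↦ repetition ↦ piece)). An ALGORITHM, however, receives a flat
list of `m' = T (nq+1) N m` samples and a flat coin string from which it reads its `ℤ_q`-scalars
(the shift coordinates and the fresh `l`'s). This file fixes, once and for all, the numbering
conventions shared by the analysis and by the oracle machine of `regev_decision_to_search`
(`LWEHardness.lean`), and proves that they carry the flat product law onto `outerLaw`: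

* index types: `QIdx = Fin T × Est × Fin N` (queries), `QIdx × Fin m` (sample slots and fresh
  scalars `l`), `ScalarPos = (Fin T × Fin n) ⊕ (QIdx × Fin m)` (all scalars read off the coins);
* numberings (all built from `finProdFinEquiv`, `finSumFinEquiv`, Mathlib's `ZMod.finEquiv`):
  `estEquiv` (`none ↦ 0`, `some (i, k) ↦ 1 + q i + k.val`), `qIdxEquiv`
  (`(j, e, rep) ↦ (j (nq+1) + e#) N + rep`), `slotEquiv` (`(qi, idx) ↦ qi# · m + idx`: query
  number `qi#` uses input block `qi#`), `posEquiv` (`inl (j, i) ↦ j n + i`,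
  `inr (qi, idx) ↦ T n + slot#`);
* `assemble v S : Outer` and its inverse (`assembleEquiv`);
* **`iidPMF_map_comp_equiv`**: an iid tuple reindexed along any bijection is the product law
  `piLaw` on the new index type; **`outerLaw_eq_map_assemble`**:
  `outerLaw χ s m N T = (piLaw U_{ℤ_q}^{ScalarPos} ⊗ A_{s,χ}^{m'} reindexed).map assemble` — exact,
  by comparing product masses.

## References

* O. Regev, *On lattices, learning with errors, random linear codes, and cryptography*, J. ACM 56
  (2009), art. 34, §4, Lemmas 4.1–4.2 (held: arXiv:2401.03703, p. 23). [cite: RegevLWE2009, §4 Lemma 4.1–4.2]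
-/

noncomputable section

namespace Literature.Computability.Cryptography

namespace LWE

namespace RegevReduction

open Finset Literature.Probability.Distributions
open scoped ENNReal

set_option synthInstance.maxSize 512

variable {n q m N T : ℕ}

/-! ### Index types and numberings -/

/-- Query indices: round `j`, estimate `e`, repetition `rep`. [cite: RegevLWE2009, §4 Lemma 4.1–4.2] -/
abbrev QIdx (n q N T : ℕ) : Type := Fin T × Est n q × Fin N

/-- Positions of the `ℤ_q`-scalars the reduction reads off its coins: shift coordinates
`(j, i)` and fresh scalars `l` for every sample slot `(query, idx)`. [cite: RegevLWE2009, §4 (proofs of Lemmas 4.1, 4.2)] -/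
abbrev ScalarPos (n q m N T : ℕ) : Type := (Fin T × Fin n) ⊕ (QIdx n q N T × Fin m)

/-- The value of Mathlib's numbering `(ZMod.finEquiv q).symm : ℤ_q ≃ Fin q` is `ZMod.val`. [folklore] -/
@[simp] theorem finEquiv_symm_apply_val [NeZero q] (k : ZMod q) : (((ZMod.finEquiv q).symm k : Fin q) : ℕ) = k.val := by
  obtain ⟨q', rfl⟩ : ∃ q', q = q' + 1 := Nat.exists_eq_succ_of_ne_zero (NeZero.ne q)
  rfl

/-- Numbering of the estimates: `none ↦ 0`, `some (i, k) ↦ 1 + (q i + k.val)`. [folklore] -/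
def estEquiv (n q : ℕ) [NeZero q] : Est n q ≃ Fin (n * q + 1) :=
  (Equiv.optionEquivSumPUnit (Fin n × ZMod q)).trans <|
    (Equiv.sumComm _ _).trans <|
      (Equiv.sumCongr finOneEquiv.symm
          ((Equiv.prodCongr (Equiv.refl (Fin n)) (ZMod.finEquiv q).toEquiv.symm).trans finProdFinEquiv)).trans <|
        finSumFinEquiv.trans (finCongr (Nat.add_comm 1 (n * q)))

/-- `estEquiv none = 0`. [folklore] -/
@[simp] theorem estEquiv_none_val [NeZero q] : (estEquiv n q none).val = 0 := by
  simp [estEquiv]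

/-- `estEquiv (some (i, k)) = k.val + q i + 1`. [folklore] -/
@[simp] theorem estEquiv_some_val [NeZero q] (i : Fin n) (k : ZMod q) :
    (estEquiv n q (some (i, k))).val = k.val + q * i + 1 := by
  simp [estEquiv]

/-- Numbering of the queries: `(j, e, rep) ↦ (j (nq+1) + e#) N + rep`. [folklore] -/
def qIdxEquiv (n q N T : ℕ) [NeZero q] : QIdx n q N T ≃ Fin (T * (n * q + 1) * N) :=
  (Equiv.prodCongr (Equiv.refl (Fin T)) (Equiv.prodCongr (estEquiv n q) (Equiv.refl (Fin N)))).trans <|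
    (Equiv.prodAssoc (Fin T) (Fin (n * q + 1)) (Fin N)).symm.trans <|
      (Equiv.prodCongr finProdFinEquiv (Equiv.refl (Fin N))).trans finProdFinEquiv

/-- The query number. [folklore] -/
theorem qIdxEquiv_apply_val [NeZero q] (j : Fin T) (e : Est n q) (rep : Fin N) :
    (qIdxEquiv n q N T (j, e, rep)).val = rep + N * ((estEquiv n q e).val + (n * q + 1) * j) := by
  simp [qIdxEquiv]

/-- Numbering of the sample slots (= of the fresh scalars `l`): `(qi, idx) ↦ qi# · m + idx`, so that
query number `qi#` consumes input block number `qi#`. [folklore] -/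
def slotEquiv (n q m N T : ℕ) [NeZero q] : QIdx n q N T × Fin m ≃ Fin (T * (n * q + 1) * N * m) :=
  (Equiv.prodCongr (qIdxEquiv n q N T) (Equiv.refl (Fin m))).trans finProdFinEquiv

/-- The slot number. [folklore] -/
theorem slotEquiv_apply_val [NeZero q] (qi : QIdx n q N T) (idx : Fin m) :
    (slotEquiv n q m N T (qi, idx)).val = idx + m * (qIdxEquiv n q N T qi).val := by
  simp [slotEquiv]

/-- Numbering of the scalar positions: shift coordinates first (`(j, i) ↦ j n + i`), then the fresh
scalars by slot number. [folklore] -/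
def posEquiv (n q m N T : ℕ) [NeZero q] : ScalarPos n q m N T ≃ Fin (T * n + T * (n * q + 1) * N * m) :=
  (Equiv.sumCongr finProdFinEquiv (slotEquiv n q m N T)).trans finSumFinEquiv

/-- The position of a shift coordinate. [folklore] -/
theorem posEquiv_inl_val [NeZero q] (j : Fin T) (i : Fin n) :
    (posEquiv n q m N T (Sum.inl (j, i))).val = i + n * j := by
  simp [posEquiv]

/-- The position of a fresh scalar. [folklore] -/
theorem posEquiv_inr_val [NeZero q] (u : QIdx n q N T × Fin m) :
    (posEquiv n q m N T (Sum.inr u)).val = T * n + (slotEquiv n q m N T u).val := by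
  simp [posEquiv]

/-! ### Assembling the structured data -/

/-- Assemble the data of the outer experiment from the family of scalars and the family of
samples. [cite: RegevLWE2009, §4 Lemma 4.1–4.2] -/
def assemble (v : ScalarPos n q m N T → ZMod q) (S : QIdx n q N T × Fin m → (Fin n → ZMod q) × ZMod q) :
    Outer n q m N T :=
  fun j => (fun i => v (Sum.inl (j, i)), fun e rep idx => (v (Sum.inr ((j, e, rep), idx)), S ((j, e, rep), idx)))

/-- `assemble` is a bijection (its inverse reads the scalars and samples back off the rounds).
[folklore] -/
def assembleEquiv (n q m N T : ℕ) :
    (ScalarPos n q m N T → ZMod q) × (QIdx n q N T × Fin m → (Fin n → ZMod q) × ZMod q) ≃ Outer n q m N T where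
  toFun p := assemble p.1 p.2
  invFun Ω := (fun pos => match pos with
      | Sum.inl ji => (Ω ji.1).1 ji.2
      | Sum.inr u => ((Ω u.1.1).2 u.1.2.1 u.1.2.2 u.2).1,
    fun u => ((Ω u.1.1).2 u.1.2.1 u.1.2.2 u.2).2)
  left_inv p := by
    obtain ⟨v, S⟩ := p
    refine Prod.ext (funext fun pos => ?_) (funext fun u => ?_)
    · cases pos with
      | inl ji => rfl
      | inr u => rfl
    · rfl
  right_inv Ω := by
    funext j
    rfl

/-- `assembleEquiv` is `assemble`. [folklore] -/
@[simp] theorem assembleEquiv_apply (p : (ScalarPos n q m N T → ZMod q) × (QIdx n q N T × Fin m → (Fin n → ZMod q) × ZMod q)) :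
    assembleEquiv n q m N T p = assemble p.1 p.2 := rfl

/-! ### Laws: reindexed iid tuples and the assembled outer law -/

/-- Mass of `prodLaw` at a pair variable (uncurried `prodLaw_apply`). [folklore] -/
private theorem prodLaw_apply' {α β : Type*} (p : PMF α) (r : PMF β) (x : α × β) : prodLaw p r x = p x.1 * r x.2 := by
  obtain ⟨a, b⟩ := x
  exact prodLaw_apply p r a b

/-- Mass of `pairLaw` at a pair variable (uncurried `pairLaw_apply`). [folklore] -/
private theorem pairLaw_apply' {ι R : Type} [CommRing R] [Fintype R] (P : PMF ((ι → R) × R)) (y : R × ((ι → R) × R)) :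
    pairLaw P y = (Fintype.card R : ℝ≥0∞)⁻¹ * P y.2 := by
  obtain ⟨l, x⟩ := y
  exact pairLaw_apply P l x

/-- **An iid tuple reindexed along a bijection is the product law on the new index type.**
[folklore] -/
theorem iidPMF_map_comp_equiv {α I : Type} [Fintype I] [DecidableEq I] [Fintype α] (p : PMF α) {M : ℕ}
    (σ : I ≃ Fin M) : (iidPMF p M).map (fun S => S ∘ σ) = piLaw fun _ : I => p := by
  have hbij : Function.Bijective fun S : Fin M → α => S ∘ σ :=
    (Equiv.arrowCongr σ (Equiv.refl α)).symm.bijective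
  ext f
  rw [show (fun S : Fin M → α => S ∘ σ) = Equiv.ofBijective _ hbij from rfl, pmf_map_equiv_apply,
    piLaw_apply]
  have hsymm : (Equiv.ofBijective _ hbij).symm f = f ∘ σ.symm := by
    rw [Equiv.symm_apply_eq]
    simp [Function.comp_def]
  rw [hsymm, iidPMF_apply_holds p M (f ∘ σ.symm)]
  exact Fintype.prod_equiv σ.symm _ _ fun u => rfl

variable [NeZero q]

/-- **The flat product law assembles to `outerLaw`**: independent uniform scalars at all positions
and independent samples from `A_{s,χ}` at all slots, assembled, have exactly the law of the outer
experiment. [cite: RegevLWE2009, §4 Lemma 4.1–4.2] -/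
theorem outerLaw_eq_map_assemble (χ : PMF (ZMod q)) (s : Secret n q) :
    outerLaw χ s (m := m) N T =
      (prodLaw (piLaw fun _ : ScalarPos n q m N T => PMF.uniformOfFintype (ZMod q))
          (piLaw fun _ : QIdx n q N T × Fin m => lweSample χ s)).map (fun p => assemble p.1 p.2) := by
  classical
  set c : ℝ≥0∞ := ((q : ℝ≥0∞))⁻¹ with hc
  have hiid : ∀ v : Piece n q m, iidPMF (pairLaw (lweSample χ s)) m v = ∏ idx, pairLaw (lweSample χ s) (v idx) :=
    fun v => iidPMF_apply_holds _ m v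
  ext Ω
  -- the right-hand side: `c ^ #positions * ∏_u A(S u)`
  rw [show (fun p : (ScalarPos n q m N T → ZMod q) × (QIdx n q N T × Fin m → (Fin n → ZMod q) × ZMod q) =>
      assemble p.1 p.2) = assembleEquiv n q m N T from rfl, pmf_map_equiv_apply, prodLaw_apply',
    piLaw_apply, piLaw_apply]
  have hSdef : ∀ u : QIdx n q N T × Fin m,
      ((assembleEquiv n q m N T).symm Ω).2 u = ((Ω u.1.1).2 u.1.2.1 u.1.2.2 u.2).2 := fun u => rfl
  have hvU : ∀ pos : ScalarPos n q m N T,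
      PMF.uniformOfFintype (ZMod q) (((assembleEquiv n q m N T).symm Ω).1 pos) = c := fun pos => by
    rw [PMF.uniformOfFintype_apply, ZMod.card]
  simp only [hvU, hSdef, Finset.prod_const, Finset.card_univ]
  -- the left-hand side, round by round
  have hround : ∀ j : Fin T,
      prodLaw (PMF.uniformOfFintype (Secret n q)) (innerLaw χ s m N) (Ω j) =
        c ^ n * ∏ e : Est n q, ∏ rep : Fin N,
          (c ^ m * ∏ idx : Fin m, (lweSample χ s ((Ω j).2 e rep idx).2 : ℝ≥0∞)) := by
    intro j
    rw [prodLaw_apply', PMF.uniformOfFintype_apply, Fintype.card_fun, ZMod.card, Fintype.card_fin,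
      innerLaw, piLaw_apply]
    congr 1
    · rw [hc, Nat.cast_pow, ENNReal.inv_pow]
    · refine Finset.prod_congr rfl fun e _ => ?_
      rw [piLaw_apply]
      refine Finset.prod_congr rfl fun rep _ => ?_
      rw [pieceLaw, hiid]
      simp only [pairLaw_apply', ZMod.card]
      rw [Finset.prod_mul_distrib, Finset.prod_const, Finset.card_univ, Fintype.card_fin]
  rw [outerLaw, piLaw_apply]
  simp only [hround, Finset.prod_mul_distrib, Finset.prod_const, Finset.card_univ, Fintype.card_fin]
  -- the sample factors agree after reindexing along the product structure
  have hS : (∏ j : Fin T, ∏ e : Est n q, ∏ rep : Fin N, ∏ idx : Fin m,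
      (lweSample χ s ((Ω j).2 e rep idx).2 : ℝ≥0∞)) =
      ∏ u : QIdx n q N T × Fin m, (lweSample χ s ((Ω u.1.1).2 u.1.2.1 u.1.2.2 u.2).2 : ℝ≥0∞) := by
    simp only [Fintype.prod_prod_type]
  rw [hS, ← mul_assoc]
  congr 1
  -- the constants: `(c^n)^T · ((c^m)^N)^(nq+1))^T = c^(T n + T (nq+1) N m)`
  simp only [← pow_mul, ← pow_add, Fintype.card_sum, Fintype.card_prod, Fintype.card_fin, card_est]
  congr 1
  ring

end RegevReduction


end LWE

end Literature.Computability.Cryptography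

end
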